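import Mathlib
import HarnessLib
import Summits.NavierStokesRegularity.NavierStokesRegularity.Theorems.CompletionRelayChainRelayFrontStepIgnitionJoint
import Summits.NavierStokesRegularity.NavierStokesRegularity.Theorems.CompletionRelayChainRelayFrontStepIgnitionRelay
import Summits.NavierStokesRegularity.NavierStokesRegularity.Theorems.CompletionRelayChainRelayFrontStepIgnitionLinear

/-!
# `CompletionRelayChain` — crux `RelayFrontStep` (24850), LINE `window_v2`, stub `stub_ignition` (Phase II):
  ONE PIECE of the ignition clock (blueprint §3): the analytic step behind one row of the clock table

On a piece `[a, b]` of the Phase-II window on which the front trigger `u = u₁` runs through the level band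
`[w_j, w_{j+1}]` (`u(a) ≥ w_j`, `u ≤ w_{j+1}`), given the differential inequalities of the relay rows with
constant defects (`x₂′ ≤ Λu² + ε_x`, `u′ ≥ Λ(x₁−x₂)u − ε₁`, `r₁′ ≤ (Λ/32)u·x₂ + ε_r`,
`r₁′ ≥ −(Λ/32)u·u₂⁺ − ε_rl`, `u₂′ ≤ k·u₂ + β_U`, `(−u₂)′ ≤ k·(−u₂) + β_m`, `0 ≤ k ≤ 32(x₂ + c_K)`), the start
bounds at `a` (`x₂(a) ≤ X_j + (u(a)² − w_j²)/(2m)`, `r₁(a) ≤ R_j`, `u₂(a) ≤ U_j`, `−u₂(a) ≤ Um_j`,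
`−r₁(a) ≤ Rm_j`) and the ROW INEQUALITIES of the table (hypotheses `c1 … c8`, rational checks in
`…IgnitionTable`), `piece_step` concludes on the whole piece: `x₂ ≤ X_{j+1}`, `u ≥ w_j − D`, `Λ m u ≤ u′`,
`t − a ≤ ds_j`, `r₁ ≤ R_{j+1}`, `u₂ ≤ U_{j+1}`, `−u₂ ≤ Um_{j+1}`, `−r₁ ≤ Rm_{j+1}`. Tools: `clock_piece_joint`
(p617139), `clock_piece_time`/`clock_piece_r1` (p615339), `linear_comparison_var` (p616453),
`lower_linear_of_derivWithin_ge` (p615755).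

No definitions. HONEST FRAMING: elementary calculus; helper for the crux, no stub credit; nothing here is a statement
about the Navier–Stokes equations.
-/

noncomputable section

-- the summit-side namespace repeats a component by design (D-0017)
set_option linter.dupNamespace false

open Set MeasureTheory intervalIntegral

namespace Summit.NavierStokesRegularity.NavierStokesRegularity.Cruxes.RelayFrontStep.Window2

/-- **ONE PIECE OF THE CLOCK.** See the module docstring; `θ = 1001/1000` is the slack of the joint bootstrap,
`Λlo ≤ Λ` a rational lower bound of the clock, `7/10` the window length cap. [folklore; this file] -/
theorem piece_step {u x₁ x₂ r₁ u₂ k : ℝ → ℝ}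
    {τ a b Λ Λlo εx ε₁ εr εrl βU βm cK Mu s₀ m dm D wj wn Xj Xn Rj Rn Uj Un Umj Umn Rmj Rmn ds G : ℝ}
    (hτ : 0 < τ) (hu : ContDiffOn ℝ 1 u (Icc 0 τ)) (hx₂ : ContDiffOn ℝ 1 x₂ (Icc 0 τ))
    (hr₁ : ContDiffOn ℝ 1 r₁ (Icc 0 τ)) (hu₂ : ContDiffOn ℝ 1 u₂ (Icc 0 τ)) (hk : ContinuousOn k (Icc 0 τ))
    (ha : 0 ≤ a) (hab : a ≤ b) (hb : b ≤ τ) (hlen : b - a ≤ 7 / 10)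
    (hΛlo : 0 < Λlo) (hΛ : Λlo ≤ Λ) (hεx : 0 ≤ εx) (hε₁ : 0 ≤ ε₁) (hεr : 0 ≤ εr) (hεrl : 0 ≤ εrl)
    (hβU : 0 ≤ βU) (hβm : 0 ≤ βm) (hcK : 0 ≤ cK)
    -- the band and the rows on the piece
    (hwj : wj ≤ u a) (hwn : ∀ s ∈ Icc a b, u s ≤ wn) (hMu : ∀ s ∈ Icc a b, |u s| ≤ Mu)
    (hs₀ : ∀ s ∈ Icc a b, s₀ ≤ x₁ s + x₂ s)
    (hx₂' : ∀ s ∈ Icc a b, derivWithin x₂ (Icc 0 τ) s ≤ Λ * u s ^ 2 + εx)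
    (hu' : ∀ s ∈ Icc a b, Λ * (x₁ s - x₂ s) * u s - ε₁ ≤ derivWithin u (Icc 0 τ) s)
    {Lu : ℝ} (hLu : 0 ≤ Lu) (hu'crude : ∀ s ∈ Icc a b, -Lu ≤ derivWithin u (Icc 0 τ) s)
    (hr₁' : ∀ s ∈ Icc a b, derivWithin r₁ (Icc 0 τ) s ≤ Λ / 32 * u s * x₂ s + εr)
    (hr₁'lo : ∀ s ∈ Icc a b, -(Λ / 32 * u s * max (u₂ s) 0) - εrl ≤ derivWithin r₁ (Icc 0 τ) s)
    (hu₂' : ∀ s ∈ Icc a b, derivWithin u₂ (Icc 0 τ) s ≤ k s * u₂ s + βU)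
    (hu₂'m : ∀ s ∈ Icc a b, derivWithin (fun r => -u₂ r) (Icc 0 τ) s ≤ k s * (-u₂ s) + βm)
    (hk0 : ∀ s ∈ Icc a b, 0 ≤ k s) (hkx : ∀ s ∈ Icc a b, k s ≤ 32 * (x₂ s + cK))
    -- start bounds
    (hx₂a : x₂ a ≤ Xj + (u a ^ 2 - wj ^ 2) / (2 * m)) (hr₁a : r₁ a ≤ Rj) (hu₂a : u₂ a ≤ Uj)
    (hu₂am : -u₂ a ≤ Umj) (hr₁am : -r₁ a ≤ Rmj)
    -- row checks
    (c1 : m ≤ s₀ - 2 * ((1001 / 1000) * Xn) - dm) (c1' : 0 < m) (c1'' : 0 ≤ dm)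
    (c2 : ε₁ ≤ Λlo * dm * (wj - (1001 / 1000) * D)) (c2' : (1001 / 1000) * D < wj) (c2'' : ε₁ * (7 / 10) ≤ D)
    (c2''' : 0 < D)
    (c3 : Xj + (wn ^ 2 - wj ^ 2) / (2 * m) + εx * (7 / 10) ≤ Xn) (c3' : 0 < Xn)
    (c4 : Real.log (wn / wj) ≤ ds * (Λ * m)) (hds : 0 ≤ ds)
    (c5 : Rj + Xn * (wn - wj) / (32 * m) + εr * ds ≤ Rn)
    (c6 : (Uj + βU * ds) * G ≤ Un) (c6' : Real.exp (32 * (Xn + cK) * ds) ≤ G) (c6'' : 0 ≤ Uj)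
    (c7 : (Umj + βm * ds) * G ≤ Umn) (c7' : 0 ≤ Umj)
    (c8 : Rmj + (Λ / 32 * wn * Un + εrl) * ds ≤ Rmn) (c8' : 0 ≤ Un) :
    ∀ t ∈ Icc a b, x₂ t ≤ Xn ∧ wj - D ≤ u t ∧ Λ * m * u t ≤ derivWithin u (Icc 0 τ) t ∧ t - a ≤ ds ∧
      r₁ t ≤ Rn ∧ u₂ t ≤ Un ∧ -u₂ t ≤ Umn ∧ -r₁ t ≤ Rmn := by
  have hΛ0 : 0 ≤ Λ := hΛlo.le.trans hΛ
  have hwjpos : 0 < wj := lt_of_le_of_lt (by positivity) c2'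
  have huapos : 0 < u a := hwjpos.trans_le hwj
  have hsubI : Icc a b ⊆ Icc 0 τ := Icc_subset_Icc ha hb
  -- the joint bootstrap on [a, b] with wa := u a, wa' := u a − D
  set wa : ℝ := u a with hwa
  have hw'' : 0 < (wa - D) - ((1001 / 1000 : ℝ) - 1) * (wa - (wa - D)) := by
    have : wa - D - ((1001 / 1000 : ℝ) - 1) * (wa - (wa - D)) = wa - (1001 / 1000) * D := by ring
    rw [this]; linarith
  have hdrop : ε₁ * (b - a) ≤ wa - (wa - D) := by
    have : ε₁ * (b - a) ≤ ε₁ * (7 / 10) := mul_le_mul_of_nonneg_left hlen hε₁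
    linarith
  have hgap : dm ≤ s₀ - 2 * ((1001 / 1000) * Xn) - m := by linarith
  have hε₁' : ε₁ ≤ Λ * (s₀ - 2 * ((1001 / 1000) * Xn) - m) * ((wa - D) - ((1001 / 1000 : ℝ) - 1) * (wa - (wa - D))) := by
    have e : (wa - D) - ((1001 / 1000 : ℝ) - 1) * (wa - (wa - D)) = wa - (1001 / 1000) * D := by ring
    rw [e]
    have h1 : Λlo * dm * (wj - (1001 / 1000) * D) ≤ Λ * (s₀ - 2 * ((1001 / 1000) * Xn) - m) * (wa - (1001 / 1000) * D) := by
      have hA : 0 ≤ wj - (1001 / 1000) * D := by linarith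
      have hB : wj - (1001 / 1000) * D ≤ wa - (1001 / 1000) * D := by linarith
      calc Λlo * dm * (wj - (1001 / 1000) * D) ≤ Λ * dm * (wj - (1001 / 1000) * D) := by
            gcongr
        _ ≤ Λ * (s₀ - 2 * ((1001 / 1000) * Xn) - m) * (wj - (1001 / 1000) * D) := by
            apply mul_le_mul_of_nonneg_right _ hA; exact mul_le_mul_of_nonneg_left hgap hΛ0
        _ ≤ Λ * (s₀ - 2 * ((1001 / 1000) * Xn) - m) * (wa - (1001 / 1000) * D) := by
            apply mul_le_mul_of_nonneg_left hB; exact mul_nonneg hΛ0 (c1''.trans hgap)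
    exact c2.trans h1
  have hroom : (Xj + (u a ^ 2 - wj ^ 2) / (2 * m)) + (wn ^ 2 - wa ^ 2) / (2 * m) + εx * (b - a) ≤ Xn := by
    have e : (Xj + (u a ^ 2 - wj ^ 2) / (2 * m)) + (wn ^ 2 - wa ^ 2) / (2 * m) = Xj + (wn ^ 2 - wj ^ 2) / (2 * m) := by
      rw [hwa]; field_simp; ring
    rw [e]
    have : εx * (b - a) ≤ εx * (7 / 10) := mul_le_mul_of_nonneg_left hlen hεx
    linarith
  -- the joint bootstrap: x₂ ≤ Xn and the trigger floor on [a, b]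
  obtain ⟨hX, hfl⟩ := clock_piece_joint (x₁ := x₁) (θ := 1001 / 1000) hτ hu hx₂ ha hab hb hΛ0 c1' (by norm_num) c3' hεx
    hε₁ hLu (by linarith : wa - D < wa) hw'' (le_refl (u a)) hdrop hwn hMu hs₀ hx₂a hx₂' hu' hu'crude
    (by linarith [c1, c1''] : m ≤ s₀ - 2 * ((1001 / 1000) * Xn)) hε₁' hroom
  -- consequences on [a, b]
  have hupos : ∀ t ∈ Icc a b, wj - D ≤ u t := by
    intro t ht
    have h1 := hfl t ht
    have h2 : ε₁ * (t - a) ≤ ε₁ * (7 / 10) := mul_le_mul_of_nonneg_left (by linarith [ht.2]) hε₁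
    linarith
  have hgrow : ∀ t ∈ Icc a b, Λ * m * u t ≤ derivWithin u (Icc 0 τ) t := by
    intro t ht
    have h1 := hu' t ht; have h2 := hs₀ t ht; have h3 := hX t ht; have h4 := hupos t ht
    have h5 : m + dm ≤ x₁ t - x₂ t := by linarith only [h2, h3, c1, c3'.le]
    have hut : 0 ≤ u t := by linarith
    -- Λ (x₁ − x₂) u ≥ Λ (m + dm) u = Λ m u + Λ dm u ≥ Λ m u + Λlo dm (wj − D) ≥ Λ m u + ε₁
    have h6 : Λ * (m + dm) * u t ≤ Λ * (x₁ t - x₂ t) * u t :=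
      mul_le_mul_of_nonneg_right (mul_le_mul_of_nonneg_left h5 hΛ0) hut
    have h7 : Λlo * dm * (wj - (1001 / 1000) * D) ≤ Λ * dm * u t := by
      have hA : 0 ≤ wj - (1001 / 1000) * D := by linarith
      calc Λlo * dm * (wj - (1001 / 1000) * D) ≤ Λ * dm * (wj - (1001 / 1000) * D) := by gcongr
        _ ≤ Λ * dm * u t := by
            apply mul_le_mul_of_nonneg_left _ (mul_nonneg hΛ0 c1''); linarith only [h4, c2''']
    have e : Λ * (m + dm) * u t = Λ * m * u t + Λ * dm * u t := by ring
    linarith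
  have hΛm : 0 < Λ * m := mul_pos (hΛlo.trans_le hΛ) c1'
  have htime : ∀ t ∈ Icc a b, t - a ≤ ds := by
    intro t ht
    have h1 := clock_piece_time hu ha ht.1 (ht.2.trans hb) hΛm huapos (le_refl (u a)) (hwn t ht)
      (fun s hs => hgrow s ⟨hs.1, hs.2.trans ht.2⟩)
    -- log (wn / u a) ≤ log (wn / wj)
    have hwnpos : 0 < wn := huapos.trans_le (hwn a (left_mem_Icc.mpr hab))
    have h2 : Real.log (wn / u a) ≤ Real.log (wn / wj) := by
      apply Real.log_le_log (div_pos hwnpos huapos)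
      exact div_le_div_of_nonneg_left hwnpos.le hwjpos hwj
    have h3 : Real.log (wn / u a) / (Λ * m) ≤ ds := by
      rw [div_le_iff₀ hΛm]; exact h2.trans c4
    exact h1.trans h3
  have hr₁b : ∀ t ∈ Icc a b, r₁ t ≤ Rn := by
    intro t ht
    have h1 := clock_piece_r1 (X := Xn) (ε := εr) hτ hu hr₁ ha ht.1 (ht.2.trans hb) c1' c3'.le (le_refl (u a)) (hwn t ht)
      (fun s hs => hgrow s ⟨hs.1, hs.2.trans ht.2⟩)
      (fun s hs => by
        have hs' : s ∈ Icc a b := ⟨hs.1, hs.2.trans ht.2⟩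
        have h2 := hr₁' s hs'
        have h3 : u s * x₂ s ≤ u s * Xn := mul_le_mul_of_nonneg_left (hX s hs') (by linarith [hupos s hs'])
        have h4 : Λ / 32 * u s * x₂ s ≤ Λ / 32 * u s * Xn := by
          have := mul_le_mul_of_nonneg_left h3 (by positivity : 0 ≤ Λ / 32); linarith [this]
        linarith)
    have h2 : Xn * (wn - u a) / (32 * m) ≤ Xn * (wn - wj) / (32 * m) := by
      apply div_le_div_of_nonneg_right _ (by positivity)
      exact mul_le_mul_of_nonneg_left (by linarith) c3'.le
    have h3 : εr * (t - a) ≤ εr * ds := mul_le_mul_of_nonneg_left (htime t ht) hεr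
    linarith
  -- u₂ and −u₂ by the one-sided linear comparison with K := 32 (Xn + cK)
  have hK : ∀ s ∈ Icc a b, k s ≤ 32 * (Xn + cK) := fun s hs => (hkx s hs).trans (by linarith [hX s hs])
  have hexp : ∀ t ∈ Icc a b, Real.exp (32 * (Xn + cK) * (t - a)) ≤ G := by
    intro t ht
    refine (Real.exp_le_exp.mpr ?_).trans c6'
    exact mul_le_mul_of_nonneg_left (htime t ht) (by positivity)
  have hu₂b : ∀ t ∈ Icc a b, u₂ t ≤ Un := by
    intro t ht
    have h1 := linear_comparison_var hu₂ hk ha hab hb hβU hk0 hK hu₂' t ht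
    have h2 : max 0 (u₂ a + βU * (t - a)) ≤ Uj + βU * ds :=
      max_le (add_nonneg c6'' (mul_nonneg hβU hds)) (by linarith only [hu₂a, mul_le_mul_of_nonneg_left (htime t ht) hβU])
    have h3 := mul_le_mul h2 (hexp t ht) (Real.exp_pos _).le (add_nonneg c6'' (mul_nonneg hβU hds))
    linarith
  have hu₂mb : ∀ t ∈ Icc a b, -u₂ t ≤ Umn := by
    intro t ht
    have h1 := linear_comparison_var (y := fun r => -u₂ r) hu₂.neg hk ha hab hb hβm hk0 hK hu₂'m t ht
    have h2 : max 0 (-u₂ a + βm * (t - a)) ≤ Umj + βm * ds :=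
      max_le (add_nonneg c7' (mul_nonneg hβm hds)) (by linarith only [hu₂am, mul_le_mul_of_nonneg_left (htime t ht) hβm])
    have h3 := mul_le_mul h2 (hexp t ht) (Real.exp_pos _).le (add_nonneg c7' (mul_nonneg hβm hds))
    have : (fun r => -u₂ r) t = -u₂ t := rfl
    linarith
  -- the relay floor
  have hr₁mb : ∀ t ∈ Icc a b, -r₁ t ≤ Rmn := by
    intro t ht
    have h1 := lower_linear_of_derivWithin_ge (C := Λ / 32 * wn * Un + εrl) hτ hr₁ ha ht.1 (ht.2.trans hb)
      (fun s hs => by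
        have hs' : s ∈ Icc a b := ⟨hs.1, hs.2.trans ht.2⟩
        have h2 := hr₁'lo s hs'
        have hus : 0 ≤ u s := by linarith [hupos s hs']
        have hm0 : 0 ≤ max (u₂ s) 0 := le_max_right _ _
        have hmU : max (u₂ s) 0 ≤ Un := max_le (hu₂b s hs') c8'
        have h3 : u s * max (u₂ s) 0 ≤ wn * Un := mul_le_mul (hwn s hs') hmU hm0 (hus.trans (hwn s hs'))
        have h4 := mul_le_mul_of_nonneg_left h3 (by positivity : 0 ≤ Λ / 32)
        linarith) t ⟨ht.1, le_rfl⟩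
    have h2 : (Λ / 32 * wn * Un + εrl) * (t - a) ≤ (Λ / 32 * wn * Un + εrl) * ds :=
      mul_le_mul_of_nonneg_left (htime t ht) (by
        have : 0 ≤ wn := huapos.le.trans (hwn a (left_mem_Icc.mpr hab)); positivity)
    linarith
  intro t ht
  exact ⟨hX t ht, hupos t ht, hgrow t ht, htime t ht, hr₁b t ht, hu₂b t ht, hu₂mb t ht, hr₁mb t ht⟩

/-- **ONE PIECE OF THE CLOCK, raw sources.** As `piece_step`, but the sources of `u₂′` and `(−u₂)′` are taken in
the raw form `β₀ + L32·r₁⁺·u₁` / `β₀ + L32·r₁⁻·u₁` (the relay bound of the piece is produced inside, before the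
trigger bound that needs it), with `Λ/32 ≤ L32`. See the module docstring; `θ = 1001/1000` is the slack of the joint bootstrap,
`Λlo ≤ Λ` a rational lower bound of the clock, `7/10` the window length cap. [folklore; this file] -/
theorem piece_step_raw {u x₁ x₂ r₁ u₂ k : ℝ → ℝ}
    {τ a b Λ Λlo L32 εx ε₁ εr εrl β₀ cK Mu s₀ m dm D wj wn Xj Xn Rj Rn Uj Un Umj Umn Rmj Rmn ds G : ℝ}
    (hτ : 0 < τ) (hu : ContDiffOn ℝ 1 u (Icc 0 τ)) (hx₂ : ContDiffOn ℝ 1 x₂ (Icc 0 τ))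
    (hr₁ : ContDiffOn ℝ 1 r₁ (Icc 0 τ)) (hu₂ : ContDiffOn ℝ 1 u₂ (Icc 0 τ)) (hk : ContinuousOn k (Icc 0 τ))
    (ha : 0 ≤ a) (hab : a ≤ b) (hb : b ≤ τ) (hlen : b - a ≤ 7 / 10)
    (hΛlo : 0 < Λlo) (hΛ : Λlo ≤ Λ) (hεx : 0 ≤ εx) (hε₁ : 0 ≤ ε₁) (hεr : 0 ≤ εr) (hεrl : 0 ≤ εrl)
    (hβ₀ : 0 ≤ β₀) (hL32 : 0 ≤ L32) (hcK : 0 ≤ cK)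
    -- the band and the rows on the piece
    (hwj : wj ≤ u a) (hwn : ∀ s ∈ Icc a b, u s ≤ wn) (hMu : ∀ s ∈ Icc a b, |u s| ≤ Mu)
    (hs₀ : ∀ s ∈ Icc a b, s₀ ≤ x₁ s + x₂ s)
    (hx₂' : ∀ s ∈ Icc a b, derivWithin x₂ (Icc 0 τ) s ≤ Λ * u s ^ 2 + εx)
    (hu' : ∀ s ∈ Icc a b, Λ * (x₁ s - x₂ s) * u s - ε₁ ≤ derivWithin u (Icc 0 τ) s)
    {Lu : ℝ} (hLu : 0 ≤ Lu) (hu'crude : ∀ s ∈ Icc a b, -Lu ≤ derivWithin u (Icc 0 τ) s)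
    (hr₁' : ∀ s ∈ Icc a b, derivWithin r₁ (Icc 0 τ) s ≤ Λ / 32 * u s * x₂ s + εr)
    (hr₁'lo : ∀ s ∈ Icc a b, -(L32 * u s * max (u₂ s) 0) - εrl ≤ derivWithin r₁ (Icc 0 τ) s)
    (hu₂' : ∀ s ∈ Icc a b, derivWithin u₂ (Icc 0 τ) s ≤ k s * u₂ s + (β₀ + L32 * max (r₁ s) 0 * u s))
    (hu₂'m : ∀ s ∈ Icc a b, derivWithin (fun r => -u₂ r) (Icc 0 τ) s ≤ k s * (-u₂ s) + (β₀ + L32 * max (-r₁ s) 0 * u s))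
    (hk0 : ∀ s ∈ Icc a b, 0 ≤ k s) (hkx : ∀ s ∈ Icc a b, k s ≤ 32 * (x₂ s + cK))
    -- start bounds
    (hx₂a : x₂ a ≤ Xj + (u a ^ 2 - wj ^ 2) / (2 * m)) (hr₁a : r₁ a ≤ Rj) (hu₂a : u₂ a ≤ Uj)
    (hu₂am : -u₂ a ≤ Umj) (hr₁am : -r₁ a ≤ Rmj)
    -- row checks
    (c1 : m ≤ s₀ - 2 * ((1001 / 1000) * Xn) - dm) (c1' : 0 < m) (c1'' : 0 ≤ dm)
    (c2 : ε₁ ≤ Λlo * dm * (wj - (1001 / 1000) * D)) (c2' : (1001 / 1000) * D < wj) (c2'' : ε₁ * (7 / 10) ≤ D)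
    (c2''' : 0 < D)
    (c3 : Xj + (wn ^ 2 - wj ^ 2) / (2 * m) + εx * (7 / 10) ≤ Xn) (c3' : 0 < Xn)
    (c4 : Real.log (wn / wj) ≤ ds * (Λ * m)) (hds : 0 ≤ ds)
    (c5 : Rj + Xn * (wn - wj) / (32 * m) + εr * ds ≤ Rn) (c5' : 0 ≤ Rn)
    (c6 : (Uj + (β₀ + L32 * Rn * wn) * ds) * G ≤ Un) (c6' : Real.exp (32 * (Xn + cK) * ds) ≤ G) (c6'' : 0 ≤ Uj)
    (c7 : (Umj + (β₀ + L32 * Rmn * wn) * ds) * G ≤ Umn) (c7' : 0 ≤ Umj)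
    (c8 : Rmj + (L32 * wn * Un + εrl) * ds ≤ Rmn) (c8' : 0 ≤ Un) (c8'' : 0 ≤ Rmj) :
    ∀ t ∈ Icc a b, x₂ t ≤ Xn ∧ wj - D ≤ u t ∧ Λ * m * u t ≤ derivWithin u (Icc 0 τ) t ∧ t - a ≤ ds ∧
      r₁ t ≤ Rn ∧ u₂ t ≤ Un ∧ -u₂ t ≤ Umn ∧ -r₁ t ≤ Rmn := by
  have hΛ0 : 0 ≤ Λ := hΛlo.le.trans hΛ
  have hwjpos : 0 < wj := lt_of_le_of_lt (by positivity) c2'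
  have huapos : 0 < u a := hwjpos.trans_le hwj
  have hsubI : Icc a b ⊆ Icc 0 τ := Icc_subset_Icc ha hb
  -- the joint bootstrap on [a, b] with wa := u a, wa' := u a − D
  set wa : ℝ := u a with hwa
  have hw'' : 0 < (wa - D) - ((1001 / 1000 : ℝ) - 1) * (wa - (wa - D)) := by
    have : wa - D - ((1001 / 1000 : ℝ) - 1) * (wa - (wa - D)) = wa - (1001 / 1000) * D := by ring
    rw [this]; linarith
  have hdrop : ε₁ * (b - a) ≤ wa - (wa - D) := by
    have : ε₁ * (b - a) ≤ ε₁ * (7 / 10) := mul_le_mul_of_nonneg_left hlen hε₁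
    linarith
  have hgap : dm ≤ s₀ - 2 * ((1001 / 1000) * Xn) - m := by linarith
  have hε₁' : ε₁ ≤ Λ * (s₀ - 2 * ((1001 / 1000) * Xn) - m) * ((wa - D) - ((1001 / 1000 : ℝ) - 1) * (wa - (wa - D))) := by
    have e : (wa - D) - ((1001 / 1000 : ℝ) - 1) * (wa - (wa - D)) = wa - (1001 / 1000) * D := by ring
    rw [e]
    have h1 : Λlo * dm * (wj - (1001 / 1000) * D) ≤ Λ * (s₀ - 2 * ((1001 / 1000) * Xn) - m) * (wa - (1001 / 1000) * D) := by
      have hA : 0 ≤ wj - (1001 / 1000) * D := by linarith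
      have hB : wj - (1001 / 1000) * D ≤ wa - (1001 / 1000) * D := by linarith
      calc Λlo * dm * (wj - (1001 / 1000) * D) ≤ Λ * dm * (wj - (1001 / 1000) * D) := by
            gcongr
        _ ≤ Λ * (s₀ - 2 * ((1001 / 1000) * Xn) - m) * (wj - (1001 / 1000) * D) := by
            apply mul_le_mul_of_nonneg_right _ hA; exact mul_le_mul_of_nonneg_left hgap hΛ0
        _ ≤ Λ * (s₀ - 2 * ((1001 / 1000) * Xn) - m) * (wa - (1001 / 1000) * D) := by
            apply mul_le_mul_of_nonneg_left hB; exact mul_nonneg hΛ0 (c1''.trans hgap)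
    exact c2.trans h1
  have hroom : (Xj + (u a ^ 2 - wj ^ 2) / (2 * m)) + (wn ^ 2 - wa ^ 2) / (2 * m) + εx * (b - a) ≤ Xn := by
    have e : (Xj + (u a ^ 2 - wj ^ 2) / (2 * m)) + (wn ^ 2 - wa ^ 2) / (2 * m) = Xj + (wn ^ 2 - wj ^ 2) / (2 * m) := by
      rw [hwa]; field_simp; ring
    rw [e]
    have : εx * (b - a) ≤ εx * (7 / 10) := mul_le_mul_of_nonneg_left hlen hεx
    linarith
  -- the joint bootstrap: x₂ ≤ Xn and the trigger floor on [a, b]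
  obtain ⟨hX, hfl⟩ := clock_piece_joint (x₁ := x₁) (θ := 1001 / 1000) hτ hu hx₂ ha hab hb hΛ0 c1' (by norm_num) c3' hεx
    hε₁ hLu (by linarith : wa - D < wa) hw'' (le_refl (u a)) hdrop hwn hMu hs₀ hx₂a hx₂' hu' hu'crude
    (by linarith [c1, c1''] : m ≤ s₀ - 2 * ((1001 / 1000) * Xn)) hε₁' hroom
  -- consequences on [a, b]
  have hupos : ∀ t ∈ Icc a b, wj - D ≤ u t := by
    intro t ht
    have h1 := hfl t ht
    have h2 : ε₁ * (t - a) ≤ ε₁ * (7 / 10) := mul_le_mul_of_nonneg_left (by linarith [ht.2]) hε₁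
    linarith
  have hgrow : ∀ t ∈ Icc a b, Λ * m * u t ≤ derivWithin u (Icc 0 τ) t := by
    intro t ht
    have h1 := hu' t ht; have h2 := hs₀ t ht; have h3 := hX t ht; have h4 := hupos t ht
    have h5 : m + dm ≤ x₁ t - x₂ t := by linarith only [h2, h3, c1, c3'.le]
    have hut : 0 ≤ u t := by linarith
    -- Λ (x₁ − x₂) u ≥ Λ (m + dm) u = Λ m u + Λ dm u ≥ Λ m u + Λlo dm (wj − D) ≥ Λ m u + ε₁
    have h6 : Λ * (m + dm) * u t ≤ Λ * (x₁ t - x₂ t) * u t :=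
      mul_le_mul_of_nonneg_right (mul_le_mul_of_nonneg_left h5 hΛ0) hut
    have h7 : Λlo * dm * (wj - (1001 / 1000) * D) ≤ Λ * dm * u t := by
      have hA : 0 ≤ wj - (1001 / 1000) * D := by linarith
      calc Λlo * dm * (wj - (1001 / 1000) * D) ≤ Λ * dm * (wj - (1001 / 1000) * D) := by gcongr
        _ ≤ Λ * dm * u t := by
            apply mul_le_mul_of_nonneg_left _ (mul_nonneg hΛ0 c1''); linarith only [h4, c2''']
    have e : Λ * (m + dm) * u t = Λ * m * u t + Λ * dm * u t := by ring
    linarith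
  have hΛm : 0 < Λ * m := mul_pos (hΛlo.trans_le hΛ) c1'
  have htime : ∀ t ∈ Icc a b, t - a ≤ ds := by
    intro t ht
    have h1 := clock_piece_time hu ha ht.1 (ht.2.trans hb) hΛm huapos (le_refl (u a)) (hwn t ht)
      (fun s hs => hgrow s ⟨hs.1, hs.2.trans ht.2⟩)
    -- log (wn / u a) ≤ log (wn / wj)
    have hwnpos : 0 < wn := huapos.trans_le (hwn a (left_mem_Icc.mpr hab))
    have h2 : Real.log (wn / u a) ≤ Real.log (wn / wj) := by
      apply Real.log_le_log (div_pos hwnpos huapos)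
      exact div_le_div_of_nonneg_left hwnpos.le hwjpos hwj
    have h3 : Real.log (wn / u a) / (Λ * m) ≤ ds := by
      rw [div_le_iff₀ hΛm]; exact h2.trans c4
    exact h1.trans h3
  have hr₁b : ∀ t ∈ Icc a b, r₁ t ≤ Rn := by
    intro t ht
    have h1 := clock_piece_r1 (X := Xn) (ε := εr) hτ hu hr₁ ha ht.1 (ht.2.trans hb) c1' c3'.le (le_refl (u a)) (hwn t ht)
      (fun s hs => hgrow s ⟨hs.1, hs.2.trans ht.2⟩)
      (fun s hs => by
        have hs' : s ∈ Icc a b := ⟨hs.1, hs.2.trans ht.2⟩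
        have h2 := hr₁' s hs'
        have h3 : u s * x₂ s ≤ u s * Xn := mul_le_mul_of_nonneg_left (hX s hs') (by linarith [hupos s hs'])
        have h4 : Λ / 32 * u s * x₂ s ≤ Λ / 32 * u s * Xn := by
          have := mul_le_mul_of_nonneg_left h3 (by positivity : 0 ≤ Λ / 32); linarith [this]
        linarith)
    have h2 : Xn * (wn - u a) / (32 * m) ≤ Xn * (wn - wj) / (32 * m) := by
      apply div_le_div_of_nonneg_right _ (by positivity)
      exact mul_le_mul_of_nonneg_left (by linarith) c3'.le
    have h3 : εr * (t - a) ≤ εr * ds := mul_le_mul_of_nonneg_left (htime t ht) hεr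
    linarith
  -- u₂ and −u₂ by the one-sided linear comparison with K := 32 (Xn + cK)
  have hK : ∀ s ∈ Icc a b, k s ≤ 32 * (Xn + cK) := fun s hs => (hkx s hs).trans (by linarith [hX s hs])
  have hexp : ∀ t ∈ Icc a b, Real.exp (32 * (Xn + cK) * (t - a)) ≤ G := by
    intro t ht
    refine (Real.exp_le_exp.mpr ?_).trans c6'
    exact mul_le_mul_of_nonneg_left (htime t ht) (by positivity)
  have hwn0 : 0 ≤ wn := huapos.le.trans (hwn a (left_mem_Icc.mpr hab))
  have hβU : 0 ≤ β₀ + L32 * Rn * wn := by positivity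
  have hu₂'c : ∀ s ∈ Icc a b, derivWithin u₂ (Icc 0 τ) s ≤ k s * u₂ s + (β₀ + L32 * Rn * wn) := by
    intro s hs
    have h1 := hu₂' s hs
    have hus : 0 ≤ u s := by linarith [hupos s hs, c2''']
    have hmax : max (r₁ s) 0 ≤ Rn := max_le (hr₁b s hs) c5'
    have h2 : max (r₁ s) 0 * u s ≤ Rn * wn := mul_le_mul hmax (hwn s hs) hus c5'
    have h3 := mul_le_mul_of_nonneg_left h2 hL32
    linarith
  have hu₂b : ∀ t ∈ Icc a b, u₂ t ≤ Un := by
    intro t ht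
    have h1 := linear_comparison_var hu₂ hk ha hab hb hβU hk0 hK hu₂'c t ht
    have h2 : max 0 (u₂ a + (β₀ + L32 * Rn * wn) * (t - a)) ≤ Uj + (β₀ + L32 * Rn * wn) * ds :=
      max_le (add_nonneg c6'' (mul_nonneg hβU hds)) (by linarith only [hu₂a, mul_le_mul_of_nonneg_left (htime t ht) hβU])
    have h3 := mul_le_mul h2 (hexp t ht) (Real.exp_pos _).le (add_nonneg c6'' (mul_nonneg hβU hds))
    linarith
  -- the relay floor
  have hr₁mb : ∀ t ∈ Icc a b, -r₁ t ≤ Rmn := by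
    intro t ht
    have h1 := lower_linear_of_derivWithin_ge (C := L32 * wn * Un + εrl) hτ hr₁ ha ht.1 (ht.2.trans hb)
      (fun s hs => by
        have hs' : s ∈ Icc a b := ⟨hs.1, hs.2.trans ht.2⟩
        have h2 := hr₁'lo s hs'
        have hus : 0 ≤ u s := by linarith [hupos s hs']
        have hm0 : 0 ≤ max (u₂ s) 0 := le_max_right _ _
        have hmU : max (u₂ s) 0 ≤ Un := max_le (hu₂b s hs') c8'
        have h3 : u s * max (u₂ s) 0 ≤ wn * Un := mul_le_mul (hwn s hs') hmU hm0 (hus.trans (hwn s hs'))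
        have h4 := mul_le_mul_of_nonneg_left h3 hL32
        linarith) t ⟨ht.1, le_rfl⟩
    have h2 : (L32 * wn * Un + εrl) * (t - a) ≤ (L32 * wn * Un + εrl) * ds :=
      mul_le_mul_of_nonneg_left (htime t ht) (by positivity)
    linarith
  have hRmn0 : 0 ≤ Rmn := c8''.trans (by
    have : 0 ≤ (L32 * wn * Un + εrl) * ds := by positivity
    linarith)
  have hβm : 0 ≤ β₀ + L32 * Rmn * wn := by positivity
  have hu₂'mc : ∀ s ∈ Icc a b, derivWithin (fun r => -u₂ r) (Icc 0 τ) s ≤ k s * (-u₂ s) + (β₀ + L32 * Rmn * wn) := by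
    intro s hs
    have h1 := hu₂'m s hs
    have hus : 0 ≤ u s := by linarith [hupos s hs, c2''']
    have hmax : max (-r₁ s) 0 ≤ Rmn := max_le (hr₁mb s hs) hRmn0
    have h2 : max (-r₁ s) 0 * u s ≤ Rmn * wn := mul_le_mul hmax (hwn s hs) hus hRmn0
    have h3 := mul_le_mul_of_nonneg_left h2 hL32
    linarith
  have hu₂mb : ∀ t ∈ Icc a b, -u₂ t ≤ Umn := by
    intro t ht
    have h1 := linear_comparison_var (y := fun r => -u₂ r) hu₂.neg hk ha hab hb hβm hk0 hK hu₂'mc t ht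
    have h2 : max 0 (-u₂ a + (β₀ + L32 * Rmn * wn) * (t - a)) ≤ Umj + (β₀ + L32 * Rmn * wn) * ds :=
      max_le (add_nonneg c7' (mul_nonneg hβm hds)) (by linarith only [hu₂am, mul_le_mul_of_nonneg_left (htime t ht) hβm])
    have h3 := mul_le_mul h2 (hexp t ht) (Real.exp_pos _).le (add_nonneg c7' (mul_nonneg hβm hds))
    have : (fun r => -u₂ r) t = -u₂ t := rfl
    linarith
  intro t ht
  exact ⟨hX t ht, hupos t ht, hgrow t ht, htime t ht, hr₁b t ht, hu₂b t ht, hu₂mb t ht, hr₁mb t ht⟩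

end Summit.NavierStokesRegularity.NavierStokesRegularity.Cruxes.RelayFrontStep.Window2
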